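import Summits.ABC.IUTFork.Joshi.ATS4RowsCEFReading3Genuine
import HarnessLib

/-!
# [J-IV] Lemma 6.7.1 (3) ⟹ (2) at the primes of `30ℓ` — the `p = 2` part DISCHARGED, the odd part REDUCED to roots of unity

Block E / R-J, rows Y-21c / Y-21e / Y-21f, clause (i) («`30ℓ ∣ disc L′`», LOCATED at the Weil pairing in the
cell text). Two elementary discriminant facts and their cell instances:

* `dvd_discr_of_isPrimitiveRoot` — if a number field `K` contains a primitive `p`-th root of unity for an odd
  prime `p`, then `p ∣ disc K` (`disc ℚ(ζ_p) = ± p^{p−2}`, Mathlib `IsCyclotomicExtension.Rat.discr_prime`, and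
  `disc ℚ(ζ_p) ∣ disc K`, Mathlib `NumberField.discr_dvd_discr`);
* `two_dvd_discr_of_sq_eq_neg_one` — if `K ∋ i` with `i² = −1`, then `2 ∣ disc K` (`disc ℚ(i) = −4`).

Consequently, for a theta field `F` of [IUTchIV] Cor. 2.2 (`IsThetaField P F`: `√−1 ∈ F`) and EVERY number field
`K ⊇ F` — in particular Joshi's `L′ = L(E[ℓ]) ⊇ F` — `2 ∣ disc K` holds in kernel
(`two_dvd_discr_of_isThetaField_algebra`, `two_mem_primeFactors_discr_of_isThetaField_algebra`): the `p = 2`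
instance of the located clause is PROVED with no Weil pairing. For `p ∈ {3, 5, ℓ}` the clause is REDUCED to
«`K` contains a primitive `p`-th root of unity» (`dvd_discr_of_isPrimitiveRoot`), which is exactly what the Weil
pairing (`μ_p ⊂ F(E[p])`) supplies — and the Weil pairing IS in the tree (LOCATOR CORRECTION of v1/v2's «not in
the tree», E-cx-3 g4 00:54:25Z, adopted by E-plan 01:02:25Z (1)): `WeierstrassCurve.exists_weilPairing_holds`
(`Literature/NumberTheory/EllipticCurves/WeilPairingProofs.lean`), `exists_isPrimitiveRoot_mem_adjoin`
(`DivisionValuesRootsOfUnity.lean`: a primitive `q`-th root of unity in `F(E[q])`), `natCard_geomTorsion_prime_eq_sq`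
(`DivisionFieldRamificationDividesProofs.lean`). The odd part is discharged from these, at Joshi's reading
`L′ ⊇ F(E_F[ℓ])`, in the companion `Joshi/ATS4Reading3DiscOddPart.lean` (E-cx-3 g4: `3·5 ∣ disc K` for every
`K ⊇ F` over a theta field, `P ∈ U` — `thirty_dvd_discr_of_isThetaField_algebra`; `ℓ ∣ disc K` whenever
`ψ(K) ⊇ F(E_F[ℓ])`, i.e. every `τ ∈ Γ_F` fixing `ψ(K)` fixes `E_F[ℓ]` pointwise —
`dvd_discr_of_fixing_torsion_thetaCurve`). HONEST SCOPE: the E5 residual binders' `K` carries the OPPOSITE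
inclusion `ψ(K) ⊆ F(E[ℓ])`, so nothing here or there asserts `ℓ ∣ disc K` for THAT `K`.

PROOF-ONLY (0 `def`s, no new `Prop`-valued fact, no `sorry`). DEFS-FREEZE respected (no frozen file imported for
editing; `IsThetaField` consumed by the field name `sqrt_neg_one`). No side taken on [IUTchIII] Cor. 3.12 /
[IUTchIV] Thm. 1.10 / [J-IV] Lemma 6.7.1 or on any author; [J-IV] is an unrefereed preprint, claim-tagged
`disputed`; typed ≠ proved ≠ endorsed; not S-bearing; no abc claim.
-/

open NumberField

namespace Summit.ABC.IUTFork.Joshi.ATS4.GenuineVdst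

universe u

/-- **An odd prime `p` divides the discriminant of every number field containing a primitive `p`-th root of
unity**: `ℚ(ζ_p) ⊆ K`, `disc ℚ(ζ_p) = (−1)^{(p−1)/2} p^{p−2}` with `p − 2 ≥ 1` (Mathlib
`IsCyclotomicExtension.Rat.discr_prime`), and `disc ℚ(ζ_p) ∣ disc K` (Mathlib `NumberField.discr_dvd_discr`).
[folklore] -/
theorem dvd_discr_of_isPrimitiveRoot {K : Type u} [Field K] [NumberField K] {p : ℕ} (hp : p.Prime)
    (hp2 : p ≠ 2) {ζ : K} (hζ : IsPrimitiveRoot ζ p) : (p : ℤ) ∣ discr K := by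
  haveI : Fact p.Prime := ⟨hp⟩
  haveI : NeZero p := ⟨hp.ne_zero⟩
  let K₀ : Type u := ↥(IntermediateField.adjoin ℚ ({ζ} : Set K))
  haveI : IsCyclotomicExtension {p} ℚ K₀ := IsPrimitiveRoot.intermediateField_adjoin_isCyclotomicExtension (K := ℚ) hζ
  have h0 : discr K₀ = (-1) ^ ((p - 1) / 2) * (p : ℤ) ^ (p - 2) := IsCyclotomicExtension.Rat.discr_prime p K₀
  have h1 : (p : ℤ) ∣ discr K₀ := by
    rw [h0]
    have h3 : 3 ≤ p := by
      rcases hp.eq_two_or_odd' with h | h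
      · exact absurd h hp2
      · exact Nat.succ_le_of_lt (lt_of_le_of_ne hp.two_le (fun h2 => hp2 h2.symm))
    exact Dvd.dvd.mul_left (dvd_pow_self (p : ℤ) (by omega)) _
  exact h1.trans (NumberField.discr_dvd_discr K₀ K)

/-- `i² = −1` in a field of characteristic `0` makes `i` a primitive `4`-th root of unity. [folklore] -/
theorem isPrimitiveRoot_four_of_sq_eq_neg_one {K : Type u} [Field K] [CharZero K] {i : K} (hi : i ^ 2 = -1) :
    IsPrimitiveRoot i 4 := by
  refine IsPrimitiveRoot.mk_of_lt i (by norm_num) ?_ ?_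
  · calc i ^ 4 = (i ^ 2) ^ 2 := by ring
      _ = 1 := by rw [hi]; norm_num
  · intro l hl0 hl4 h
    interval_cases l
    · -- `i = 1` contradicts `i² = −1`
      rw [pow_one] at h
      rw [h] at hi
      norm_num at hi
    · rw [hi] at h
      norm_num at h
    · have h' : i ^ 3 = i ^ 2 * i := by ring
      rw [h', hi] at h
      have : i = -1 := by linear_combination -h
      rw [this] at hi
      norm_num at hi

/-- **`2` divides the discriminant of every number field containing `√−1`**: `ℚ(i) ⊆ K`, `disc ℚ(i) = −4`
(Mathlib `IsCyclotomicExtension.Rat.discr_prime_pow_succ` at `2²`), `disc ℚ(i) ∣ disc K` (Mathlib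
`NumberField.discr_dvd_discr`). [folklore] -/
theorem two_dvd_discr_of_sq_eq_neg_one {K : Type u} [Field K] [NumberField K] {i : K} (hi : i ^ 2 = -1) :
    (2 : ℤ) ∣ discr K := by
  have hζ : IsPrimitiveRoot i (2 ^ (1 + 1)) := by
    rw [show (2 : ℕ) ^ (1 + 1) = 4 by norm_num]
    exact isPrimitiveRoot_four_of_sq_eq_neg_one hi
  haveI : Fact (2 : ℕ).Prime := ⟨Nat.prime_two⟩
  haveI : NeZero (2 ^ (1 + 1) : ℕ) := ⟨by norm_num⟩
  let K₀ : Type u := ↥(IntermediateField.adjoin ℚ ({i} : Set K))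
  haveI : IsCyclotomicExtension {2 ^ (1 + 1)} ℚ K₀ := IsPrimitiveRoot.intermediateField_adjoin_isCyclotomicExtension (K := ℚ) hζ
  have h0 := IsCyclotomicExtension.Rat.discr_prime_pow_succ 2 1 K₀
  have h1 : (2 : ℤ) ∣ discr K₀ := by
    rw [h0]
    norm_num
  exact h1.trans (NumberField.discr_dvd_discr K₀ K)

open Literature.IUT.LogVolume Literature.IUT.LogVolume.Cor22
open Literature.NumberTheory.DiophantineGeometry Literature.NumberTheory.DiophantineGeometry.GenEll

/-- **`2 ∣ disc F` for every theta field `F`** of [IUTchIV] Cor. 2.2 (`√−1 ∈ F`, field `sqrt_neg_one` of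
`IsThetaField`). [claim: Mochizuki2012, status: disputed] -/
theorem two_dvd_discr_of_isThetaField {P : NFPoint} {F : Type} [Field F] [NumberField F] [Algebra P.F F]
    (hF : IsThetaField P F) : (2 : ℤ) ∣ discr F := by
  obtain ⟨i, hi⟩ := hF.sqrt_neg_one
  exact two_dvd_discr_of_sq_eq_neg_one hi

/-- **`2 ∣ disc K` for EVERY number field `K ⊇ F` over a theta field** — in particular for Joshi's
`L′ = L(E[ℓ]) ⊇ F`: the `p = 2` instance of [J-IV] Lemma 6.7.1 (3) ⟹ (2) («primes of `30ℓ` divide `disc L′`»)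
holds in kernel with no Weil pairing. [claim: Joshi2024ATS4, status: disputed] -/
theorem two_dvd_discr_of_isThetaField_algebra {P : NFPoint} {F : Type} [Field F] [NumberField F]
    [Algebra P.F F] (hF : IsThetaField P F) (K : Type u) [Field K] [NumberField K] [Algebra F K] :
    (2 : ℤ) ∣ discr K :=
  (two_dvd_discr_of_isThetaField hF).trans (NumberField.discr_dvd_discr F K)

/-- The same in the reading-(3) set's currency: **`2 ∈ primeFactors |disc K|`** for every number field `K ⊇ F`
over a theta field. [claim: Joshi2024ATS4, status: disputed] -/
theorem two_mem_primeFactors_discr_of_isThetaField_algebra {P : NFPoint} {F : Type} [Field F] [NumberField F]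
    [Algebra P.F F] (hF : IsThetaField P F) (K : Type u) [Field K] [NumberField K] [Algebra F K] :
    2 ∈ (discr K).natAbs.primeFactors := by
  rw [Nat.mem_primeFactors]
  refine ⟨Nat.prime_two, ?_, Int.natAbs_ne_zero.mpr (NumberField.discr_ne_zero K)⟩
  exact Int.natAbs_dvd_natAbs.mpr (two_dvd_discr_of_isThetaField_algebra hF K)

/-- **The odd part REDUCED to roots of unity**: for `p ∈ {3, 5, ℓ}` (any odd prime), `p ∣ disc K` as soon as
`K` contains a primitive `p`-th root of unity — what the Weil pairing `μ_p ⊂ F(E[p]) ⊆ L′` supplies (in the tree: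
`WeierstrassCurve.exists_weilPairing_holds`, `exists_isPrimitiveRoot_mem_adjoin`; the discharge at `L′ ⊇ F(E_F[p])`
is the companion `Joshi/ATS4Reading3DiscOddPart.lean`, `dvd_discr_of_fixing_torsion_thetaCurve`).
[claim: Joshi2024ATS4, status: disputed] -/
theorem mem_primeFactors_discr_of_isPrimitiveRoot {K : Type u} [Field K] [NumberField K] {p : ℕ}
    (hp : p.Prime) (hp2 : p ≠ 2) {ζ : K} (hζ : IsPrimitiveRoot ζ p) : p ∈ (discr K).natAbs.primeFactors := by
  rw [Nat.mem_primeFactors]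
  refine ⟨hp, ?_, Int.natAbs_ne_zero.mpr (NumberField.discr_ne_zero K)⟩
  exact Int.natAbs_dvd_natAbs.mpr (dvd_discr_of_isPrimitiveRoot hp hp2 hζ)

end Summit.ABC.IUTFork.Joshi.ATS4.GenuineVdst
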